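import Mathlib
import Literature.NumberTheory.LFunctions.Zhang2022.Section4PerronIntegrability
import HarnessLib

/-!
# Zhang (2022), §4 Lemma 4.4 (proof): "This sum is split into three sums according to
# `n ≤ D⁴`, `D⁴ < n ≤ P²` and `P² < n`" — the split of the Perron integral on `Re w = −σ − 1/2`
# (typed node `Section4.ThreeWaySplit`) DISCHARGED

Topic `Literature/NumberTheory/LFunctions/Zhang2022` (Landau–Siegel audit tree; verdict-neutral).
Y. Zhang, *Discrete mean estimates and the Landau–Siegel zero*, arXiv:2211.02515v1 (2022)
[Zhang2022LandauSiegel] — **an unrefereed manuscript under adjudication.** In the proof of Lemma 4.4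
[Z22 p.19, tex L1066–L1082] the integral `(2πi)⁻¹∫_{(−σ−1/2)} L(s+w,ψ)L(s+w,ψχ)P^{(9/5)w}ω₁(w)dw/w`
is rewritten by the functional equation (`Section4.FELine`, discharged in `Section4FELine`) and
"this sum is split into three sums according to `n ≤ D⁴`, `D⁴ < n ≤ P²` and `P² < n`", giving the
three integrals of (4.7), (4.8), (4.9). The typed node `Section4.ThreeWaySplit` (L1-t3) asserts the
resulting identity of INTEGRALS; its proof needs the integrability of the pieces along the line
(left implicit in print; supplied by `Section4PerronIntegrability`):

* `LSeries_nu_psiBar_eq_three` — pointwise, for `Re z > 1` and `D⁴ ≤ P²`: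
  `Σₙ ν(n)ψ̄(n)n^{−z} = F(z,ψ̄) + Σ_{D⁴<n≤P²} ν(n)ψ̄(n)n^{−z} + Σ_{n>P²} ν(n)ψ̄(n)n^{−z}`;
* `threeWaySplit_holds : ThreeWaySplit` — unconditional (threshold: `⌈e³⌉` and the threshold of
  `feLine_holds`), for every `ψ ∈ Ψ` and `s ∈ Ω₃`.

Nothing about Theorems 1–2 of the source or about Landau–Siegel zeros is stated or implied.

## References

* Y. Zhang, arXiv:2211.02515v1 (2022), §4 p. 19 (proof of Lemma 4.4), (4.7)–(4.9).
  [cite: Zhang2022LandauSiegel, §4 Lemma 4.4 (proof)]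
-/

noncomputable section

open Complex Real ComplexConjugate MeasureTheory
open scoped LSeries.notation

namespace Literature.NumberTheory.LFunctions.Zhang2022.Section4

open Skeleton

/-! ## The three-way split of `Σ ν(n)ψ̄(n)n^{−z}` and of the Perron integral -/

section Split

variable {D : ℕ} [NeZero D] (χ : DirichletCharacter ℂ D) (x : Chr D)

omit [NeZero D] in
/-- **"This sum is split into three sums according to `n ≤ D⁴`, `D⁴ < n ≤ P²` and `P² < n`"**,
pointwise: for `Re z > 1` (absolute convergence) and `D⁴ ≤ P²`,
`Σₙ ν(n)ψ̄(n)n^{−z} = F(z,ψ̄) + midSum(z) + tailSum(z)`. [cite: Zhang2022LandauSiegel, §4 p. 19] -/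
theorem LSeries_nu_psiBar_eq_three (hq : χ.IsQuadratic) (h48 : D ^ 4 ≤ ⌊bigP D ^ 2⌋₊)
    {z : ℂ} (hz : 1 < z.re) :
    LSeries (fun n => nu χ n * psiBarFn x n) z = FpolyBar χ x z + midSum χ x z + tailSum χ x z := by
  set g : ℕ → ℂ := fun n => nu χ n * psiBarFn x n with hg
  set N : ℕ := ⌊bigP D ^ 2⌋₊ with hN
  set t : ℕ → ℂ := LSeries.term g z with ht
  have hsum : Summable t := LSeriesSummable_nu_psiBar χ x hq hz
  -- `t = A + B`, `A` supported on `n ≤ N`, `B` on `n > N`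
  set A : ℕ → ℂ := fun n => if n ≤ N then t n else 0 with hA
  set B : ℕ → ℂ := fun n => if N < n then t n else 0 with hB
  have hAB : t = fun n => A n + B n := by
    funext n
    simp only [hA, hB]
    by_cases h : n ≤ N
    · rw [if_pos h, if_neg (not_lt.mpr h), add_zero]
    · rw [if_neg h, if_pos (not_le.mp h), zero_add]
  have hAsupp : ∀ n ∉ insert 0 (Finset.Icc 1 N), A n = 0 := by
    intro n hn
    simp only [Finset.mem_insert, Finset.mem_Icc, not_or, not_and, not_le] at hn
    have h1 : 1 ≤ n := Nat.one_le_iff_ne_zero.mpr hn.1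
    rw [hA]
    simp only
    rw [if_neg (not_le.mpr (hn.2 h1))]
  have hAs : Summable A := summable_of_ne_finset_zero hAsupp
  have hBs : Summable B := by
    have : B = fun n => t n - A n := by
      funext n; rw [hAB]; simp
    rw [this]
    exact hsum.sub hAs
  have htn : ∀ n : ℕ, n ≠ 0 → t n = g n * (n : ℂ) ^ (-z) := by
    intro n hn
    rw [ht, LSeries.term_of_ne_zero hn, Complex.cpow_neg, div_eq_mul_inv]
  -- the finite part
  have hAsum : ∑' n, A n = ∑ n ∈ Finset.Icc 1 N, g n * (n : ℂ) ^ (-z) := by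
    rw [tsum_eq_sum hAsupp, Finset.sum_insert (by simp)]
    have hA0 : A 0 = 0 := by
      rw [hA]; dsimp only; rw [if_pos (Nat.zero_le _), ht, LSeries.term_zero]
    rw [hA0, zero_add]
    refine Finset.sum_congr rfl fun n hn => ?_
    have hn' := Finset.mem_Icc.mp hn
    rw [hA]; dsimp only
    rw [if_pos hn'.2, htn n (by omega)]
  have hsplit : ∑ n ∈ Finset.Icc 1 N, g n * (n : ℂ) ^ (-z) = FpolyBar χ x z + midSum χ x z := by
    have hIcc : ∀ M : ℕ, Finset.Icc 1 M = Finset.Ioc 0 M := fun M => by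
      rw [← Finset.Icc_add_one_left_eq_Ioc, zero_add]
    rw [hIcc N, ← Finset.sum_Ioc_consecutive _ (Nat.zero_le (D ^ 4)) h48, ← hIcc (D ^ 4),
      FpolyBar, midSum]
    rfl
  -- the tail
  have hBsum : ∑' n, B n = tailSum χ x z := by
    rw [tailSum]
    refine tsum_congr fun n => ?_
    have hiff : N < n ↔ bigP D ^ 2 < (n : ℝ) := Nat.floor_lt (by positivity)
    by_cases h : N < n
    · rw [hB]
      simp only
      rw [if_pos h, if_pos (hiff.mp h), htn n (by omega), hg]
    · rw [hB]
      simp only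
      rw [if_neg h, if_neg (fun h' => h (hiff.mpr h'))]
  calc LSeries g z = ∑' n, t n := rfl
    _ = ∑' n, (A n + B n) := by rw [hAB]
    _ = ∑' n, A n + ∑' n, B n := hAs.tsum_add hBs
    _ = FpolyBar χ x z + midSum χ x z + tailSum χ x z := by rw [hAsum, hsplit, hBsum]

end Split

/-! ## `Section4.ThreeWaySplit` -/

section Assembly

variable {D : ℕ} [NeZero D] (χ : DirichletCharacter ℂ D) (x : Chr D)

omit [NeZero D] in
/-- `⌈e³⌉ ≤ D` gives `3 ≤ 𝓛`. [folklore] -/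
private theorem three_le_ell {D : ℕ} (hD : ⌈Real.exp 3⌉₊ ≤ D) : 3 ≤ ell D := by
  have h : Real.exp 3 ≤ D := le_trans (Nat.le_ceil _) (by exact_mod_cast hD)
  exact (Real.le_log_iff_exp_le (lt_of_lt_of_le (Real.exp_pos _) h)).mpr h

omit [NeZero D] in
/-- `α = π/𝓛⁹ < 1/2` once `𝓛 ≥ 3`. [cite: Zhang2022LandauSiegel, §2 (2.10)] -/
private theorem alpha_lt_half {D : ℕ} (hL : 3 ≤ ell D) : alpha D < 1 / 2 := by
  rw [alpha, bigP, Real.log_exp]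
  have h9 : (3 : ℝ) ^ 9 ≤ ell D ^ 9 := pow_le_pow_left₀ (by norm_num) hL 9
  rw [div_lt_iff₀ (by positivity)]
  nlinarith [Real.pi_lt_four]

omit [NeZero D] in
/-- `D⁴ ≤ ⌊P²⌋` once `𝓛 ≥ 3` (`D⁴ = e^{4𝓛} ≤ e^{2𝓛⁹} = P²`). [cite: Zhang2022LandauSiegel, §2 (2.6)] -/
private theorem pow_four_le_floor_bigP_sq {D : ℕ} (hL : 3 ≤ ell D) (hD0 : 0 < D) :
    D ^ 4 ≤ ⌊bigP D ^ 2⌋₊ := by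
  refine Nat.le_floor ?_
  have hD' : (0 : ℝ) < D := by exact_mod_cast hD0
  have h1 : ((D ^ 4 : ℕ) : ℝ) = Real.exp (4 * ell D) := by
    rw [Nat.cast_pow, ell, ← Real.exp_log (pow_pos hD' 4), Real.log_pow]; norm_num
  have h2 : bigP D ^ 2 = Real.exp (2 * ell D ^ 9) := by
    rw [bigP, ← Real.exp_nat_mul]; norm_num
  rw [h1, h2, Real.exp_le_exp]
  have h8 : (3 : ℝ) ^ 8 ≤ ell D ^ 8 := pow_le_pow_left₀ (by norm_num) hL 8
  nlinarith

/-- **`Section4.ThreeWaySplit` HOLDS** (threshold: the larger of `⌈e³⌉` and the threshold of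
`feLine_holds`): on `Re w = −σ − 1/2` the Perron integral of `L(s+w,ψ)L(s+w,ψχ)` is the sum of
the three Perron integrals of `Z̃(s+w)F(1−s−w,ψ̄)`, `Z̃(s+w)Σ_{D⁴<n≤P²}…`, `Z̃(s+w)Σ_{n>P²}…` —
by the functional equation pointwise, the three-way split of the absolutely convergent series at
`Re(1−s−w) = 3/2`, and linearity of the integral, each piece being integrable (`|Z̃| ≪ (1+|v|)²`,
Gaussian `ω₁`). [cite: Zhang2022LandauSiegel, §4 Lemma 4.4 (proof) p. 19] -/
theorem threeWaySplit_holds : ThreeWaySplit := by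
  obtain ⟨D₁, hFE⟩ := feLine_holds
  refine ⟨max D₁ ⌈Real.exp 3⌉₊, fun D _ χ hD hq hp x s hs => ?_⟩
  have hD₁ : D₁ ≤ D := le_trans (le_max_left _ _) hD
  have hD3' : ⌈Real.exp 3⌉₊ ≤ D := le_trans (le_max_right _ _) hD
  have hL3 : 3 ≤ ell D := three_le_ell hD3'
  have hL0 : 0 < ell D := by linarith
  have hD0 : 0 < D := NeZero.pos D
  have hα : alpha D < 1 / 2 := alpha_lt_half hL3
  have h48 : D ^ 4 ≤ ⌊bigP D ^ 2⌋₊ := pow_four_le_floor_bigP_sq hL3 hD0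
  have hs1 : 1 / 2 - alpha D < s.re := hs.1
  set a : ℝ := -s.re - 1 / 2 with ha_def
  have ha0 : a ≠ 0 := by rw [ha_def]; linarith
  -- the line `Re(s + w) = −1/2` and `Re(1 − s − w) = 3/2`
  have hca : (s + (a : ℂ)).re = -1 / 2 := by simp [ha_def]; ring
  have hz : ∀ v : ℝ, (s + ((a : ℂ) + v * I)).re = -1 / 2 := fun v => by simp [ha_def]; ring
  have hz' : ∀ v : ℝ, (1 - s - ((a : ℂ) + v * I)).re = 3 / 2 := fun v => by
    simp [ha_def]; ring
  -- the coefficient sequence and its majorant on `Re = 3/2`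
  set g : ℕ → ℂ := fun n => nu χ n * psiBarFn x n with hg
  have hg32 : LSeriesSummable g ((3 / 2 : ℝ) : ℂ) :=
    LSeriesSummable_nu_psiBar χ x hq (by simp; norm_num)
  set M₀ : ℝ := ∑' n, ‖LSeries.term g (3 / 2 : ℝ) n‖ with hM₀
  set M₁ : ℝ := ∑ n ∈ Finset.Icc 1 (D ^ 4), ‖nu χ n‖ with hM₁
  set M₂ : ℝ := ∑ n ∈ Finset.Ioc (D ^ 4) ⌊bigP D ^ 2⌋₊, ‖nu χ n‖ with hM₂
  set Cψ : ℝ := ‖GammaFactor.tau x.ψ‖ * (x.p : ℝ) ^ (1 / 2 : ℝ) with hCψ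
  set Cχψ : ℝ := ‖GammaFactor.tau (psiChi χ x)‖ * ((D * x.p : ℕ) : ℝ) ^ (1 / 2 : ℝ) with hCχψ
  -- `|Z̃(s + a + iv)| ≤ Cψ Cχψ (1 + |s+a|)² (1+|v|)²`
  have hZ : ∀ v : ℝ, ‖tildeZW χ x (s + ((a : ℂ) + v * I))‖
      ≤ Cψ * Cχψ * (1 + ‖s + (a : ℂ)‖) ^ 2 * (1 + |v|) ^ 2 := by
    intro v
    have h1 := norm_tildeZW_le_of_re χ x (hz v)
    have hn : ‖s + ((a : ℂ) + v * I)‖ ≤ ‖s + (a : ℂ)‖ + |v| := by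
      calc ‖s + ((a : ℂ) + v * I)‖ = ‖(s + (a : ℂ)) + v * I‖ := by rw [add_assoc]
        _ ≤ ‖s + (a : ℂ)‖ + ‖(v : ℂ) * I‖ := norm_add_le _ _
        _ = ‖s + (a : ℂ)‖ + |v| := by simp
    have h0 : 0 ≤ Cψ * Cχψ := by positivity
    calc ‖tildeZW χ x (s + ((a : ℂ) + v * I))‖
        ≤ Cψ * Cχψ * (1 + ‖s + ((a : ℂ) + v * I)‖) ^ 2 := h1
      _ ≤ Cψ * Cχψ * ((1 + ‖s + (a : ℂ)‖) * (1 + |v|)) ^ 2 := by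
          gcongr
          nlinarith [norm_nonneg (s + (a : ℂ)), abs_nonneg v]
      _ = Cψ * Cχψ * (1 + ‖s + (a : ℂ)‖) ^ 2 * (1 + |v|) ^ 2 := by ring
  have hZc : Continuous fun v : ℝ => tildeZW χ x (s + ((a : ℂ) + v * I)) := by
    have := continuous_tildeZW_line χ x hca
    simpa [add_assoc] using this
  -- (4.7)-integrand: `Z̃ · F(1 − s − w, ψ̄)`
  have h47c : Continuous fun v : ℝ => f47 χ x s ((a : ℂ) + v * I) := by
    have hF : Continuous fun v : ℝ => FpolyBar χ x (1 - s - ((a : ℂ) + v * I)) := by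
      simpa [FpolyBar] using continuous_sum_cpow_line (Finset.Icc 1 (D ^ 4)) (by simp)
        (fun n => nu χ n * conj (x.ψ (n : ZMod x.p))) s a
    exact hZc.mul hF
  have h47b : ∀ v : ℝ, ‖f47 χ x s ((a : ℂ) + v * I)‖
      ≤ (Cψ * Cχψ * (1 + ‖s + (a : ℂ)‖) ^ 2 * M₁) * (1 + |v|) ^ 2 := by
    intro v
    rw [f47, norm_mul]
    have hF := norm_FpolyBar_le_sum_norm χ x (z := 1 - s - ((a : ℂ) + v * I)) (by rw [hz' v]; norm_num)
    calc ‖tildeZW χ x (s + ((a : ℂ) + v * I))‖ * ‖FpolyBar χ x (1 - s - ((a : ℂ) + v * I))‖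
        ≤ (Cψ * Cχψ * (1 + ‖s + (a : ℂ)‖) ^ 2 * (1 + |v|) ^ 2) * M₁ :=
          mul_le_mul (hZ v) hF (norm_nonneg _) (by positivity)
      _ = _ := by ring
  have h47 : Integrable fun v : ℝ => perronIntegrand D (f47 χ x s) ((a : ℂ) + v * I) :=
    integrable_perronIntegrand ha0 h47c h47b hL0
  -- (4.8)-integrand: `Z̃ · midSum`
  have h48c : Continuous fun v : ℝ => f48 χ x s ((a : ℂ) + v * I) := by
    have hF : Continuous fun v : ℝ => midSum χ x (1 - s - ((a : ℂ) + v * I)) := by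
      simpa [midSum] using continuous_sum_cpow_line (Finset.Ioc (D ^ 4) ⌊bigP D ^ 2⌋₊) (by simp)
        (fun n => nu χ n * psiBarFn x n) s a
    exact hZc.mul hF
  have h48b : ∀ v : ℝ, ‖f48 χ x s ((a : ℂ) + v * I)‖
      ≤ (Cψ * Cχψ * (1 + ‖s + (a : ℂ)‖) ^ 2 * M₂) * (1 + |v|) ^ 2 := by
    intro v
    rw [f48, norm_mul]
    have hF := norm_midSum_le_sum_norm χ x (z := 1 - s - ((a : ℂ) + v * I)) (by rw [hz' v]; norm_num)
    calc ‖tildeZW χ x (s + ((a : ℂ) + v * I))‖ * ‖midSum χ x (1 - s - ((a : ℂ) + v * I))‖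
        ≤ (Cψ * Cχψ * (1 + ‖s + (a : ℂ)‖) ^ 2 * (1 + |v|) ^ 2) * M₂ :=
          mul_le_mul (hZ v) hF (norm_nonneg _) (by positivity)
      _ = _ := by ring
  have h48i : Integrable fun v : ℝ => perronIntegrand D (f48 χ x s) ((a : ℂ) + v * I) :=
    integrable_perronIntegrand ha0 h48c h48b hL0
  -- the full integrand `L(s+w,ψ)L(s+w,ψχ)`
  have hD3 : 3 ≤ D := by
    have h : Real.exp 3 ≤ D := le_trans (Nat.le_ceil _) (by exact_mod_cast hD3')
    have : (3 : ℝ) ≤ D := by linarith [Real.add_one_le_exp (3 : ℝ)]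
    exact_mod_cast this
  have hprim : (psiChi χ x).IsPrimitive := psiChiPrimitive_holds D χ x hD3 hp
  have hne2 : psiChi χ x ≠ 1 :=
    GammaFactor.ne_one_of_isPrimitive hprim
      (fun h => x.p_ne_one (Nat.eq_one_of_mul_eq_one_left h))
  have hLLc : Continuous fun v : ℝ => LL χ x (s + ((a : ℂ) + v * I)) := by
    have h1 := (DirichletCharacter.differentiable_LFunction x.ψ_ne_one).continuous
    have h2 := (DirichletCharacter.differentiable_LFunction hne2).continuous
    unfold LL
    exact (h1.comp (by fun_prop)).mul (h2.comp (by fun_prop))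
  have hFEv : ∀ v : ℝ, LL χ x (s + ((a : ℂ) + v * I))
      = tildeZW χ x (s + ((a : ℂ) + v * I)) * LSeries g (1 - s - ((a : ℂ) + v * I)) :=
    fun v => hFE D χ hD₁ hq hp x s hs _ (by simp [ha_def])
  have hLLb : ∀ v : ℝ, ‖LL χ x (s + ((a : ℂ) + v * I))‖
      ≤ (Cψ * Cχψ * (1 + ‖s + (a : ℂ)‖) ^ 2 * M₀) * (1 + |v|) ^ 2 := by
    intro v
    rw [hFEv v, norm_mul]
    have hF : ‖LSeries g (1 - s - ((a : ℂ) + v * I))‖ ≤ M₀ :=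
      norm_LSeries_le_tsum hg32 (hz' v)
    calc ‖tildeZW χ x (s + ((a : ℂ) + v * I))‖ * ‖LSeries g (1 - s - ((a : ℂ) + v * I))‖
        ≤ (Cψ * Cχψ * (1 + ‖s + (a : ℂ)‖) ^ 2 * (1 + |v|) ^ 2) * M₀ :=
          mul_le_mul (hZ v) hF (norm_nonneg _) (by positivity)
      _ = _ := by ring
  have hLL : Integrable fun v : ℝ => perronIntegrand D (fun w => LL χ x (s + w)) ((a : ℂ) + v * I) :=
    integrable_perronIntegrand ha0 hLLc hLLb hL0
  -- the pointwise split of the integrand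
  have hpt : ∀ v : ℝ, perronIntegrand D (fun w => LL χ x (s + w)) ((a : ℂ) + v * I)
      = perronIntegrand D (f47 χ x s) ((a : ℂ) + v * I) + perronIntegrand D (f48 χ x s) ((a : ℂ) + v * I)
        + perronIntegrand D (f49 χ x s) ((a : ℂ) + v * I) := by
    intro v
    have hsplit := LSeries_nu_psiBar_eq_three χ x hq h48 (z := 1 - s - ((a : ℂ) + v * I))
      (by rw [hz' v]; norm_num)
    simp only [perronIntegrand, f47, f48, f49]
    rw [hFEv v, hsplit]
    ring
  -- (4.9)-integrand by difference
  have h49 : Integrable fun v : ℝ => perronIntegrand D (f49 χ x s) ((a : ℂ) + v * I) := by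
    refine ((hLL.sub h47).sub h48i).congr (ae_of_all _ fun v => ?_)
    simp only [Pi.sub_apply]
    rw [hpt v]
    ring
  -- assemble
  have hfun : (fun v : ℝ => perronIntegrand D (fun w => LL χ x (s + w)) ((a : ℂ) + v * I))
      = fun v : ℝ => (perronIntegrand D (f47 χ x s) ((a : ℂ) + v * I)
          + perronIntegrand D (f48 χ x s) ((a : ℂ) + v * I))
          + perronIntegrand D (f49 χ x s) ((a : ℂ) + v * I) := funext hpt
  show perronLine D (fun w => LL χ x (s + w)) a
      = perronLine D (f47 χ x s) a + perronLine D (f48 χ x s) a + perronLine D (f49 χ x s) a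
  have h4748 : Integrable fun v : ℝ => perronIntegrand D (f47 χ x s) ((a : ℂ) + v * I)
      + perronIntegrand D (f48 χ x s) ((a : ℂ) + v * I) := h47.add h48i
  simp only [perronLine]
  rw [hfun, integral_add h4748 h49, integral_add h47 h48i]
  ring

end Assembly

end Literature.NumberTheory.LFunctions.Zhang2022.Section4
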